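import Summits.MatrixMultiplication.OmegaCensus.DominoPartNineZ4Z4
import Summits.MatrixMultiplication.OmegaCensus.DominoPartSevenZ4Z4Cells
import Summits.MatrixMultiplication.OmegaCensus.CubePartThreeZ4Z4
import HarnessLib

/-!
# The part-`9` domino cells over `A ↠ ℤ₄ × ℤ₄`: TPP statements, the orders `352` and `784`, census cells

ω-census `pub-omega`, family (b3), seat pub-omega-group gen 16.  Framing: lottery ticket; floor = certified bounds/negative
ranges.  VALUE: kernel theorems about the group-theoretic method (TPP capacity of dihedral-like groups) closing census cells;
NOT progress on ω.

From `no_shifted_form_nine_of_onto_z4z4` (`DominoPartNineZ4Z4.lean`):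
* `no_law_cube_19e_of_onto_z4z4`, `no_law_cube_1d9_of_onto_z4z4`, cell form `no_law_cube_one_nine_of_onto_z4z4` — no TPP
  triple of a dihedral-like group over `A ↠ ℤ₄²` (any `c₀`) with balanced coset parts, a part `1` and a part `9`, attains
  `3|S||T||U| + 8 = 8|A|`;
* `no_law_cube_three_three_of_onto_z4z4` — gen 14's part-`(3,3)` theorem (`CubePartThreeZ4Z4.lean`) in cell form;
* `no_mod_one_law_of_onto_z4z4_nine` — the assembly: no law over `A ↠ ℤ₄²` whenever every factorisation
  `cde = (|A|−1)/3` has two parts `1`, or a part `1` together with a part `3`, `5`, `7` or `9`, or two parts `3`;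
* the ORDERS `352` (`117 = 3²·13`: `(1,1,117)`, `(1,3,39)`, `(1,9,13)`, `(3,3,13)`) and `784` (`261 = 3²·29`):
  `no_mod_one_law_card_352_of_onto_z4z4`, `no_mod_one_law_card_784_of_onto_z4z4` and the instances
  **`no_mod_one_law_z4_z8_z11`** (`ℤ₄×ℤ₈×ℤ₁₁`, order `352`), **`no_mod_one_law_z4_z4_z49`, `no_mod_one_law_z4_z4_z7_z7`**
  (order `784`) — census cells `(1,9,13)@352`, `(1,9,29)@784 ×2` KERNEL and these three order lines complete (every
  abelian group of order `352` or `784` containing `ℤ₄²`, any `c₀`).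
-/

namespace Summit.MatrixMultiplication.OmegaCensus

open Finset

section DihedralLike

variable {A : Type} [AddCommGroup A] [DecidableEq A] [Fintype A] {G : Type} [Group G] [DecidableEq G]
  {ρ τ : A → G} {c₀ : A} {S T U : Finset G}

open Literature.Combinatorics.Additive

/-- **No `(1,1 | 9,9 | e,e)` law triple over `A ↠ ℤ₄ × ℤ₄`.**  Dihedral-like `G` over `A` (any `c₀`), `φ : A →+ ZMod 4 × ZMod 4`
onto; a TPP triple whose coset parts have sizes `|S₀| = |S₁| = 1`, `|T₀| = |T₁| = 9`, `|U₀| = |U₁|`.  Then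
`3|S||T||U| + 8 ≠ 8|A|`. [folklore] -/
theorem no_law_cube_19e_of_onto_z4z4
    (hρρ : ∀ a b, ρ a * ρ b = ρ (a + b)) (hρτ : ∀ a b, ρ a * τ b = τ (b - a))
    (hτρ : ∀ a b, τ a * ρ b = τ (a + b)) (hττ : ∀ a b, τ a * τ b = ρ (c₀ + b - a))
    (hρ : Function.Injective ρ) (hτ : Function.Injective τ) (hne : ∀ a b, ρ a ≠ τ b)
    (hsurj : ∀ g, (∃ a, ρ a = g) ∨ (∃ a, τ a = g))
    (φ : A →+ ZMod 4 × ZMod 4) (hφ : Function.Surjective φ)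
    (h : TripleProductProperty S T U)
    (hS₀ : (univ.filter fun a : A => ρ a ∈ S).card = 1) (hS₁ : (univ.filter fun a : A => τ a ∈ S).card = 1)
    (hT₀ : (univ.filter fun a : A => ρ a ∈ T).card = 9) (hT₁ : (univ.filter fun a : A => τ a ∈ T).card = 9)
    (hU : (univ.filter fun a : A => ρ a ∈ U).card = (univ.filter fun a : A => τ a ∈ U).card)
    (hV : 3 * (S.card * T.card * U.card) + 8 = 8 * Fintype.card A) : False := by
  classical
  obtain ⟨X, Y, β, γ, x₀, hXc, -, hinj, hPQ, hPR, hQR, hcover⟩ :=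
    domino_shifted_form_of_law hρρ hρτ hτρ hττ hρ hτ hne hsurj h hS₀ hS₁ (by rw [hT₀, hT₁]) hU hV
  rw [hT₀] at hXc
  exact no_shifted_form_nine_of_onto_z4z4 φ hφ hXc hinj hPQ hPR hQR hcover

/-- **No `(1,1 | d,d | 9,9)` law triple over `A ↠ ℤ₄ × ℤ₄`** (the size-`9` parts in `U`). [folklore] -/
theorem no_law_cube_1d9_of_onto_z4z4
    (hρρ : ∀ a b, ρ a * ρ b = ρ (a + b)) (hρτ : ∀ a b, ρ a * τ b = τ (b - a))
    (hτρ : ∀ a b, τ a * ρ b = τ (a + b)) (hττ : ∀ a b, τ a * τ b = ρ (c₀ + b - a))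
    (hρ : Function.Injective ρ) (hτ : Function.Injective τ) (hne : ∀ a b, ρ a ≠ τ b)
    (hsurj : ∀ g, (∃ a, ρ a = g) ∨ (∃ a, τ a = g))
    (φ : A →+ ZMod 4 × ZMod 4) (hφ : Function.Surjective φ)
    (h : TripleProductProperty S T U)
    (hS₀ : (univ.filter fun a : A => ρ a ∈ S).card = 1) (hS₁ : (univ.filter fun a : A => τ a ∈ S).card = 1)
    (hT : (univ.filter fun a : A => ρ a ∈ T).card = (univ.filter fun a : A => τ a ∈ T).card)
    (hU₀ : (univ.filter fun a : A => ρ a ∈ U).card = 9) (hU₁ : (univ.filter fun a : A => τ a ∈ U).card = 9)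
    (hV : 3 * (S.card * T.card * U.card) + 8 = 8 * Fintype.card A) : False := by
  classical
  obtain ⟨X, Y, β, γ, x₀, -, hYc, hinj, hPQ, hPR, hQR, hcover⟩ :=
    domino_shifted_form_of_law hρρ hρτ hτρ hττ hρ hτ hne hsurj h hS₀ hS₁ hT (by rw [hU₀, hU₁]) hV
  rw [hU₀] at hYc
  exact no_shifted_form_nine_of_onto_z4z4' φ hφ hYc hinj hPQ hPR hQR hcover

/-- **No cube law triple with parts `1` and `9` over `A ↠ ℤ₄ × ℤ₄` (cell form).**  Balanced coset parts, one `ρ`-part of size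
`1` and one of size `9`, in any of the three members: then `3|S||T||U| + 8 ≠ 8|A|`. [folklore] -/
theorem no_law_cube_one_nine_of_onto_z4z4
    (hρρ : ∀ a b, ρ a * ρ b = ρ (a + b)) (hρτ : ∀ a b, ρ a * τ b = τ (b - a))
    (hτρ : ∀ a b, τ a * ρ b = τ (a + b)) (hττ : ∀ a b, τ a * τ b = ρ (c₀ + b - a))
    (hρ : Function.Injective ρ) (hτ : Function.Injective τ) (hne : ∀ a b, ρ a ≠ τ b)
    (hsurj : ∀ g, (∃ a, ρ a = g) ∨ (∃ a, τ a = g))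
    (φ : A →+ ZMod 4 × ZMod 4) (hφ : Function.Surjective φ)
    (h : TripleProductProperty S T U)
    (hS : (univ.filter fun a : A => ρ a ∈ S).card = (univ.filter fun a : A => τ a ∈ S).card)
    (hT : (univ.filter fun a : A => ρ a ∈ T).card = (univ.filter fun a : A => τ a ∈ T).card)
    (hU : (univ.filter fun a : A => ρ a ∈ U).card = (univ.filter fun a : A => τ a ∈ U).card)
    (h1 : (univ.filter fun a : A => ρ a ∈ S).card = 1 ∨ (univ.filter fun a : A => ρ a ∈ T).card = 1 ∨
      (univ.filter fun a : A => ρ a ∈ U).card = 1)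
    (h9 : (univ.filter fun a : A => ρ a ∈ S).card = 9 ∨ (univ.filter fun a : A => ρ a ∈ T).card = 9 ∨
      (univ.filter fun a : A => ρ a ∈ U).card = 9) :
    3 * (S.card * T.card * U.card) + 8 ≠ 8 * Fintype.card A := by
  intro hV
  have hV_TUS : 3 * (T.card * U.card * S.card) + 8 = 8 * Fintype.card A := by
    rw [show T.card * U.card * S.card = S.card * T.card * U.card by ring]; exact hV
  have hV_UST : 3 * (U.card * S.card * T.card) + 8 = 8 * Fintype.card A := by
    rw [show U.card * S.card * T.card = S.card * T.card * U.card by ring]; exact hV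
  have hTUS : TripleProductProperty T U S := h.rotate
  have hUST : TripleProductProperty U S T := h.rotate.rotate
  rcases h1 with hs1 | ht1 | hu1 <;> rcases h9 with hs9 | ht9 | hu9
  · omega
  · exact no_law_cube_19e_of_onto_z4z4 hρρ hρτ hτρ hττ hρ hτ hne hsurj φ hφ h hs1 (hS ▸ hs1) ht9 (hT ▸ ht9) hU hV
  · exact no_law_cube_1d9_of_onto_z4z4 hρρ hρτ hτρ hττ hρ hτ hne hsurj φ hφ h hs1 (hS ▸ hs1) hT hu9 (hU ▸ hu9) hV
  · exact no_law_cube_1d9_of_onto_z4z4 hρρ hρτ hτρ hττ hρ hτ hne hsurj φ hφ hTUS ht1 (hT ▸ ht1) hU hs9 (hS ▸ hs9)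
      hV_TUS
  · omega
  · exact no_law_cube_19e_of_onto_z4z4 hρρ hρτ hτρ hττ hρ hτ hne hsurj φ hφ hTUS ht1 (hT ▸ ht1) hu9 (hU ▸ hu9) hS
      hV_TUS
  · exact no_law_cube_19e_of_onto_z4z4 hρρ hρτ hτρ hττ hρ hτ hne hsurj φ hφ hUST hu1 (hU ▸ hu1) hs9 (hS ▸ hs9) hT
      hV_UST
  · exact no_law_cube_1d9_of_onto_z4z4 hρρ hρτ hτρ hττ hρ hτ hne hsurj φ hφ hUST hu1 (hU ▸ hu1) hS ht9 (hT ▸ ht9)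
      hV_UST
  · omega

/-- **No cube law triple with two parts `3` over `A ↠ ℤ₄ × ℤ₄ (cell form)** — gen 14's `no_law_cube_33e_of_onto_z4z4`
and its rotations, for balanced coset parts with two `ρ`-parts of size `3`. [folklore] -/
theorem no_law_cube_three_three_of_onto_z4z4
    (hρρ : ∀ a b, ρ a * ρ b = ρ (a + b)) (hρτ : ∀ a b, ρ a * τ b = τ (b - a))
    (hτρ : ∀ a b, τ a * ρ b = τ (a + b)) (hττ : ∀ a b, τ a * τ b = ρ (c₀ + b - a))
    (hρ : Function.Injective ρ) (hτ : Function.Injective τ) (hne : ∀ a b, ρ a ≠ τ b)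
    (hsurj : ∀ g, (∃ a, ρ a = g) ∨ (∃ a, τ a = g))
    (φ : A →+ ZMod 4 × ZMod 4) (hφ : Function.Surjective φ)
    (h : TripleProductProperty S T U)
    (hS : (univ.filter fun a : A => ρ a ∈ S).card = (univ.filter fun a : A => τ a ∈ S).card)
    (hT : (univ.filter fun a : A => ρ a ∈ T).card = (univ.filter fun a : A => τ a ∈ T).card)
    (hU : (univ.filter fun a : A => ρ a ∈ U).card = (univ.filter fun a : A => τ a ∈ U).card)
    (h33 : ((univ.filter fun a : A => ρ a ∈ S).card = 3 ∧ (univ.filter fun a : A => ρ a ∈ T).card = 3) ∨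
      ((univ.filter fun a : A => ρ a ∈ T).card = 3 ∧ (univ.filter fun a : A => ρ a ∈ U).card = 3) ∨
      ((univ.filter fun a : A => ρ a ∈ S).card = 3 ∧ (univ.filter fun a : A => ρ a ∈ U).card = 3)) :
    3 * (S.card * T.card * U.card) + 8 ≠ 8 * Fintype.card A := by
  intro hV
  rcases h33 with ⟨hs3, ht3⟩ | ⟨ht3, hu3⟩ | ⟨hs3, hu3⟩
  · exact no_law_cube_33e_of_onto_z4z4 hρρ hρτ hτρ hττ hρ hτ hne hsurj φ hφ h hs3 (hS ▸ hs3) ht3 (hT ▸ ht3) hU hV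
  · exact no_law_cube_e33_of_onto_z4z4 hρρ hρτ hτρ hττ hρ hτ hne hsurj φ hφ h hS ht3 (hT ▸ ht3) hu3 (hU ▸ hu3) hV
  · exact no_law_cube_3e3_of_onto_z4z4 hρρ hρτ hτρ hττ hρ hτ hne hsurj φ hφ h hs3 (hS ▸ hs3) hT hu3 (hU ▸ hu3) hV

/-- **No `|A| ≡ 1 (mod 3)` law over `A ↠ ℤ₄ × ℤ₄`, factorisation property with parts `3, 5, 7, 9` and `(3,3)`**: if every
factorisation `cde = (|A| − 1)/3` has two parts `1`, or a part `1` together with a part `3`, `5`, `7` or `9`, or two parts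
`3`, then no dihedral-like group over `A`
(any `c₀`) has a TPP triple attaining `3|S||T||U| + 8 = 8|A|`. [folklore] -/
theorem no_mod_one_law_of_onto_z4z4_nine
    (hρρ : ∀ a b, ρ a * ρ b = ρ (a + b)) (hρτ : ∀ a b, ρ a * τ b = τ (b - a))
    (hτρ : ∀ a b, τ a * ρ b = τ (a + b)) (hττ : ∀ a b, τ a * τ b = ρ (c₀ + b - a))
    (hρ : Function.Injective ρ) (hτ : Function.Injective τ) (hne : ∀ a b, ρ a ≠ τ b)
    (hsurj : ∀ g, (∃ a, ρ a = g) ∨ (∃ a, τ a = g)) (hA : 14 ≤ Fintype.card A)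
    (φ : A →+ ZMod 4 × ZMod 4) (hφ : Function.Surjective φ)
    (hq : ∀ c d e : ℕ, 3 * (c * d * e) + 1 = Fintype.card A →
      (c = 1 ∧ d = 1) ∨ (d = 1 ∧ e = 1) ∨ (c = 1 ∧ e = 1) ∨
      ((c = 1 ∨ d = 1 ∨ e = 1) ∧
        ((c = 3 ∨ d = 3 ∨ e = 3) ∨ (c = 5 ∨ d = 5 ∨ e = 5) ∨ (c = 7 ∨ d = 7 ∨ e = 7) ∨ (c = 9 ∨ d = 9 ∨ e = 9))) ∨
      ((c = 3 ∧ d = 3) ∨ (d = 3 ∧ e = 3) ∨ (c = 3 ∧ e = 3)))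
    (h : TripleProductProperty S T U) : 3 * (S.card * T.card * U.card) + 8 ≠ 8 * Fintype.card A := by
  intro hV
  have hmod : Fintype.card A % 3 = 1 := by omega
  by_cases hnc : ((univ.filter fun a : A => ρ a ∈ S).card = (univ.filter fun a : A => τ a ∈ S).card ∧
      (univ.filter fun a : A => ρ a ∈ T).card = (univ.filter fun a : A => τ a ∈ T).card ∧
      (univ.filter fun a : A => ρ a ∈ U).card = (univ.filter fun a : A => τ a ∈ U).card)
  · obtain ⟨hS', hT', hU'⟩ := hnc
    have cS := card_eq_parts' hρ hτ hne hsurj S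
    have cT := card_eq_parts' hρ hτ hne hsurj T
    have cU := card_eq_parts' hρ hτ hne hsurj U
    set s₀ := (univ.filter fun a : A => ρ a ∈ S).card with hs₀
    set t₀ := (univ.filter fun a : A => ρ a ∈ T).card with ht₀
    set u₀ := (univ.filter fun a : A => ρ a ∈ U).card with hu₀
    have eS : S.card = 2 * s₀ := by rw [cS, ← hS']; ring
    have eT : T.card = 2 * t₀ := by rw [cT, ← hT']; ring
    have eU : U.card = 2 * u₀ := by rw [cU, ← hU']; ring
    have hprod : 3 * (s₀ * t₀ * u₀) + 1 = Fintype.card A := by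
      rw [eS, eT, eU] at hV; nlinarith
    have hV_TUS : 3 * (T.card * U.card * S.card) + 8 = 8 * Fintype.card A := by
      rw [show T.card * U.card * S.card = S.card * T.card * U.card by ring]; exact hV
    have hV_UST : 3 * (U.card * S.card * T.card) + 8 = 8 * Fintype.card A := by
      rw [show U.card * S.card * T.card = S.card * T.card * U.card by ring]; exact hV
    rcases hq s₀ t₀ u₀ hprod with ⟨h1, h1'⟩ | ⟨h1, h1'⟩ | ⟨h1, h1'⟩ | ⟨h1, h3 | h5 | h7 | h9⟩ | h33
    · obtain ⟨g, a, b, hab⟩ := two_cosets_of_two_two_law hρρ hρτ hτρ hττ hρ hτ hne hsurj hmod (by omega) h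
        (by rw [eS, h1]) (by rw [eT, h1']) hV
      exact not_two_cosets_of_onto_z4z4 φ hφ g a b hab
    · obtain ⟨g, a, b, hab⟩ := two_cosets_of_two_two_law hρρ hρτ hτρ hττ hρ hτ hne hsurj hmod (by omega) h.rotate
        (by rw [eT, h1]) (by rw [eU, h1']) hV_TUS
      exact not_two_cosets_of_onto_z4z4 φ hφ g a b hab
    · obtain ⟨g, a, b, hab⟩ := two_cosets_of_two_two_law hρρ hρτ hτρ hττ hρ hτ hne hsurj hmod (by omega)
        h.rotate.rotate (by rw [eU, h1']) (by rw [eS, h1]) hV_UST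
      exact not_two_cosets_of_onto_z4z4 φ hφ g a b hab
    · exact no_law_cube_one_three_of_onto_z4z4 hρρ hρτ hτρ hττ hρ hτ hne hsurj φ hφ h hS' hT' hU' h1 h3 hV
    · exact no_law_cube_one_five_of_onto_z4z4 hρρ hρτ hτρ hττ hρ hτ hne hsurj φ hφ h hS' hT' hU' h1 h5 hV
    · exact no_law_cube_one_seven_of_onto_z4z4 hρρ hρτ hτρ hττ hρ hτ hne hsurj φ hφ h hS' hT' hU' h1 h7 hV
    · exact no_law_cube_one_nine_of_onto_z4z4 hρρ hρτ hτρ hττ hρ hτ hne hsurj φ hφ h hS' hT' hU' h1 h9 hV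
    · exact no_law_cube_three_three_of_onto_z4z4 hρρ hρτ hτρ hττ hρ hτ hne hsurj φ hφ h hS' hT' hU' h33 hV
  · obtain ⟨g, a, b, hab⟩ :=
      two_cosets_of_mod_one_law_of_not_cube hρρ hρτ hτρ hττ hρ hτ hne hsurj hmod hA h hV hnc
    exact not_two_cosets_of_onto_z4z4 φ hφ g a b hab

/-- `cde = 117 = 3²·13`: two parts `1`, a part `1` next to a part `3` or `9`, or two parts `3`. [folklore] -/
theorem cube_factor_of_352 {c d e : ℕ} (h : 3 * (c * d * e) + 1 = 352) :
    (c = 1 ∧ d = 1) ∨ (d = 1 ∧ e = 1) ∨ (c = 1 ∧ e = 1) ∨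
      ((c = 1 ∨ d = 1 ∨ e = 1) ∧
        ((c = 3 ∨ d = 3 ∨ e = 3) ∨ (c = 5 ∨ d = 5 ∨ e = 5) ∨ (c = 7 ∨ d = 7 ∨ e = 7) ∨ (c = 9 ∨ d = 9 ∨ e = 9))) ∨
      ((c = 3 ∧ d = 3) ∨ (d = 3 ∧ e = 3) ∨ (c = 3 ∧ e = 3)) := by
  have hcde : c * (d * e) = 117 := by rw [← mul_assoc]; omega
  have hc : c ∈ Nat.divisors 117 := Nat.mem_divisors.2 ⟨Dvd.intro _ hcde, by norm_num⟩
  have hd : d ∈ Nat.divisors 117 :=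
    Nat.mem_divisors.2 ⟨Dvd.intro (c * e) (by rw [← hcde]; ring), by norm_num⟩
  rw [show Nat.divisors 117 = {1, 3, 9, 13, 39, 117} from by decide] at hc hd
  simp only [Finset.mem_insert, Finset.mem_singleton] at hc hd
  rcases hc with rfl | rfl | rfl | rfl | rfl | rfl <;> rcases hd with rfl | rfl | rfl | rfl | rfl | rfl <;> omega

/-- `cde = 261 = 3²·29`: two parts `1`, a part `1` next to a part `3` or `9`, or two parts `3`. [folklore] -/
theorem cube_factor_of_784 {c d e : ℕ} (h : 3 * (c * d * e) + 1 = 784) :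
    (c = 1 ∧ d = 1) ∨ (d = 1 ∧ e = 1) ∨ (c = 1 ∧ e = 1) ∨
      ((c = 1 ∨ d = 1 ∨ e = 1) ∧
        ((c = 3 ∨ d = 3 ∨ e = 3) ∨ (c = 5 ∨ d = 5 ∨ e = 5) ∨ (c = 7 ∨ d = 7 ∨ e = 7) ∨ (c = 9 ∨ d = 9 ∨ e = 9))) ∨
      ((c = 3 ∧ d = 3) ∨ (d = 3 ∧ e = 3) ∨ (c = 3 ∧ e = 3)) := by
  have hcde : c * (d * e) = 261 := by rw [← mul_assoc]; omega
  have hc : c ∈ Nat.divisors 261 := Nat.mem_divisors.2 ⟨Dvd.intro _ hcde, by norm_num⟩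
  have hd : d ∈ Nat.divisors 261 :=
    Nat.mem_divisors.2 ⟨Dvd.intro (c * e) (by rw [← hcde]; ring), by norm_num⟩
  rw [show Nat.divisors 261 = {1, 3, 9, 29, 87, 261} from by decide] at hc hd
  simp only [Finset.mem_insert, Finset.mem_singleton] at hc hd
  rcases hc with rfl | rfl | rfl | rfl | rfl | rfl <;> rcases hd with rfl | rfl | rfl | rfl | rfl | rfl <;> omega

/-- **`|A| = 352`, `A ↠ ℤ₄ × ℤ₄` (`ℤ₄ × ℤ₈ × ℤ₁₁` and the `2`-rank-`3` group `ℤ₂ × ℤ₄² × ℤ₁₁`): no dihedral-like group over `A`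
(any `c₀`) attains `3|S||T||U| + 8 = 8|A|`** (`(352−1)/3 = 117 = 3²·13`). [folklore] -/
theorem no_mod_one_law_card_352_of_onto_z4z4
    (hρρ : ∀ a b, ρ a * ρ b = ρ (a + b)) (hρτ : ∀ a b, ρ a * τ b = τ (b - a))
    (hτρ : ∀ a b, τ a * ρ b = τ (a + b)) (hττ : ∀ a b, τ a * τ b = ρ (c₀ + b - a))
    (hρ : Function.Injective ρ) (hτ : Function.Injective τ) (hne : ∀ a b, ρ a ≠ τ b)
    (hsurj : ∀ g, (∃ a, ρ a = g) ∨ (∃ a, τ a = g)) (hA : Fintype.card A = 352)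
    (φ : A →+ ZMod 4 × ZMod 4) (hφ : Function.Surjective φ) (h : TripleProductProperty S T U) :
    3 * (S.card * T.card * U.card) + 8 ≠ 8 * Fintype.card A :=
  no_mod_one_law_of_onto_z4z4_nine hρρ hρτ hτρ hττ hρ hτ hne hsurj (by rw [hA]; norm_num) φ hφ
    (fun c d e hcde => cube_factor_of_352 (by rw [hcde, hA])) h

/-- **`|A| = 784`, `A ↠ ℤ₄ × ℤ₄` (`ℤ₄² × ℤ₄₉`, `ℤ₄² × ℤ₇²` and the `2`-rank-`3` groups containing `ℤ₄²`): no dihedral-like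
group over `A` (any `c₀`) attains `3|S||T||U| + 8 = 8|A|`** (`(784−1)/3 = 261 = 3²·29`). [folklore] -/
theorem no_mod_one_law_card_784_of_onto_z4z4
    (hρρ : ∀ a b, ρ a * ρ b = ρ (a + b)) (hρτ : ∀ a b, ρ a * τ b = τ (b - a))
    (hτρ : ∀ a b, τ a * ρ b = τ (a + b)) (hττ : ∀ a b, τ a * τ b = ρ (c₀ + b - a))
    (hρ : Function.Injective ρ) (hτ : Function.Injective τ) (hne : ∀ a b, ρ a ≠ τ b)
    (hsurj : ∀ g, (∃ a, ρ a = g) ∨ (∃ a, τ a = g)) (hA : Fintype.card A = 784)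
    (φ : A →+ ZMod 4 × ZMod 4) (hφ : Function.Surjective φ) (h : TripleProductProperty S T U) :
    3 * (S.card * T.card * U.card) + 8 ≠ 8 * Fintype.card A :=
  no_mod_one_law_of_onto_z4z4_nine hρρ hρτ hτρ hττ hρ hτ hne hsurj (by rw [hA]; norm_num) φ hφ
    (fun c d e hcde => cube_factor_of_784 (by rw [hcde, hA])) h

end DihedralLike

/-! ## Instances -/

section Instances

variable {G : Type} [Group G] [DecidableEq G] {S T U : Finset G}

open Literature.Combinatorics.Additive

/-- **`ℤ₄ × ℤ₈ × ℤ₁₁`: no dihedral-like group over it (any `c₀`; `c₀ = 0` is `Dih`) has a TPP triple with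
`3|S||T||U| + 8 = 8 · 352`** — census cell `(1,9,13)` at `352` and the whole order line, kernel. [folklore] -/
theorem no_mod_one_law_z4_z8_z11 {ρ τ : ZMod 4 × (ZMod 8 × ZMod 11) → G} {c₀ : ZMod 4 × (ZMod 8 × ZMod 11)}
    (hρρ : ∀ a b, ρ a * ρ b = ρ (a + b)) (hρτ : ∀ a b, ρ a * τ b = τ (b - a))
    (hτρ : ∀ a b, τ a * ρ b = τ (a + b)) (hττ : ∀ a b, τ a * τ b = ρ (c₀ + b - a))
    (hρ : Function.Injective ρ) (hτ : Function.Injective τ) (hne : ∀ a b, ρ a ≠ τ b)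
    (hsurj : ∀ g, (∃ a, ρ a = g) ∨ (∃ a, τ a = g)) (h : TripleProductProperty S T U) :
    3 * (S.card * T.card * U.card) + 8 ≠ 8 * Fintype.card (ZMod 4 × (ZMod 8 × ZMod 11)) :=
  no_mod_one_law_card_352_of_onto_z4z4 hρρ hρτ hτρ hττ hρ hτ hne hsurj (by simp) _ (z4_z8_zn_onto_z4z4 11) h

/-- **`ℤ₄ × ℤ₄ × ℤ₄₉` (`≅ ℤ₄ × ℤ₁₉₆`): no dihedral-like group over it (any `c₀`) has a TPP triple with
`3|S||T||U| + 8 = 8 · 784`** — census cell `(1,9,29)` at `784` and the whole order line, kernel. [folklore] -/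
theorem no_mod_one_law_z4_z4_z49 {ρ τ : ZMod 4 × (ZMod 4 × ZMod 49) → G} {c₀ : ZMod 4 × (ZMod 4 × ZMod 49)}
    (hρρ : ∀ a b, ρ a * ρ b = ρ (a + b)) (hρτ : ∀ a b, ρ a * τ b = τ (b - a))
    (hτρ : ∀ a b, τ a * ρ b = τ (a + b)) (hττ : ∀ a b, τ a * τ b = ρ (c₀ + b - a))
    (hρ : Function.Injective ρ) (hτ : Function.Injective τ) (hne : ∀ a b, ρ a ≠ τ b)
    (hsurj : ∀ g, (∃ a, ρ a = g) ∨ (∃ a, τ a = g)) (h : TripleProductProperty S T U) :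
    3 * (S.card * T.card * U.card) + 8 ≠ 8 * Fintype.card (ZMod 4 × (ZMod 4 × ZMod 49)) :=
  no_mod_one_law_card_784_of_onto_z4z4 hρρ hρτ hτρ hττ hρ hτ hne hsurj (by simp) _ (z4_z4_zn_onto_z4z4 49) h

/-- **`ℤ₄ × ℤ₄ × ℤ₇ × ℤ₇` (`≅ ℤ₂₈²`): no dihedral-like group over it (any `c₀`) has a TPP triple with
`3|S||T||U| + 8 = 8 · 784`** — census cell `(1,9,29)` at `784`, kernel. [folklore] -/
theorem no_mod_one_law_z4_z4_z7_z7 {ρ τ : ZMod 4 × (ZMod 4 × (ZMod 7 × ZMod 7)) → G}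
    {c₀ : ZMod 4 × (ZMod 4 × (ZMod 7 × ZMod 7))}
    (hρρ : ∀ a b, ρ a * ρ b = ρ (a + b)) (hρτ : ∀ a b, ρ a * τ b = τ (b - a))
    (hτρ : ∀ a b, τ a * ρ b = τ (a + b)) (hττ : ∀ a b, τ a * τ b = ρ (c₀ + b - a))
    (hρ : Function.Injective ρ) (hτ : Function.Injective τ) (hne : ∀ a b, ρ a ≠ τ b)
    (hsurj : ∀ g, (∃ a, ρ a = g) ∨ (∃ a, τ a = g)) (h : TripleProductProperty S T U) :
    3 * (S.card * T.card * U.card) + 8 ≠ 8 * Fintype.card (ZMod 4 × (ZMod 4 × (ZMod 7 × ZMod 7))) :=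
  no_mod_one_law_card_784_of_onto_z4z4 hρρ hρτ hτρ hττ hρ hτ hne hsurj (by simp)
    ((AddMonoidHom.id (ZMod 4)).prodMap (AddMonoidHom.fst (ZMod 4) (ZMod 7 × ZMod 7)))
    (fun q => ⟨(q.1, (q.2, 0)), Prod.ext rfl rfl⟩) h

end Instances

end Summit.MatrixMultiplication.OmegaCensus
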